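import Summits.CriticalPhenomena.SAWScalingLimit.Theorems.SAWLeftRightFKGFKGToTraversalBoundGatesDefs
import HarnessLib

/-!
# Vocabulary of line `gates-by-bubble-doors-by-fkg`, reshape r2 (crux `FKGToTraversalBound`, stmt-CriticalPhenomena-1878)

Second vocabulary file of the registered skeleton `Cruxes/FKGToTraversalBound/Lines/gates_by_bubble_doors_by_fkg.lean`
(lead prover-line-stmt-CriticalPhenomena-1878-a3-0, reshape r2 of 2026-08-16, after wave 1 of stub workers): the repaired
rate-free germ input `GermExcursionMeanJohn` (STUB 7), the John/carrot hypothesis `IsJohnMarked`, carrier-presentability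
`CarrierPresentable`, the split of the deep fragment into the necklace class `DeepShellTightNecklace` (STUB 6) and the
explicit residue `DeepShellTightResidual` (STUB 6r), and the registered cover glue
`deepShellTight_of_necklace_of_residual`.  Kept in its own file so that the first vocabulary file
(`SAWLeftRightFKGFKGToTraversalBoundGatesDefs.lean`, p124859) stays byte-identical for its importers.

Only definitions used as HYPOTHESIS NAMES of stubs (not literature facts) and one closed glue theorem.
-/

noncomputable section

open MeasureTheory Filter Topology Set Metric
open scoped NNReal ENNReal
open Literature.Probability.LatticeModels
open Literature.Probability.RandomPlanarGeometry
open Literature.Probability.RandomPlanarGeometry.SAW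
open Summit.CriticalPhenomena.SAWScalingLimit.Theses.SAWLeftRightFKG
open Summit.CriticalPhenomena.SAWScalingLimit.Theorems.FKGToTraversalBound.Negative (dom lrLE)

namespace Summit.CriticalPhenomena.SAWScalingLimit.Theorems.FKGToTraversalBound.GatesByBubbleDoorsByFKG

/-! ## Reshape r2 of the skeleton (lead a3, 2026-08-16): the repaired germ input and the split of the deep fragment

`GermExcursionMean` (quantified over ALL Dobrushin domains) is FALSE as typed — certified by the lead's stub worker with the
deterministic "rosary" witness: a Jordan domain with an infinitely petalled channel ending at the marked prime end `D.pt 0`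
forces EVERY chord from the deep start in the `j`-th room to make `j` separate traversals of the crossover annulus,
`j → ∞` as `δ → 0` (`Cruxes/FKGToTraversalBound/Lines/gates-by-bubble-doors-by-fkg-stub7-false.md`; the boundary-approximation
case is the landed `germExcursionMean_of_bdry`).  The repaired input carries a METRIC (John / carrot) tameness hypothesis on
`D` (`IsJohnMarked`); the necklace mechanism then delivers the deep fragment on John domains at CARRIER-PRESENTABLE meshes
(`DeepShellTightNecklace`), and the other non-presentable meshes — non-John domains, and the non-carrier-presentable meshes of
the scope findings S-1 (dropped edges) / S-2 (ringed exterior sites, `necklace_not_carrierPresentable_of_ringed`) — form the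
explicit residue `DeepShellTightResidual`; `deepShellTight_of_necklace_of_residual` is the cover glue. -/

/-- The lattice domain `D_δ` is CARRIER-PRESENTABLE: its graph is the graph of an r2 carrier `dom C δ` for some closed
lattice walk `C` (no condition on the endpoints; `Presentable` adds the two boundary-adjacency clauses —
`necklace_presentable_iff`).
[folklore] -/
def CarrierPresentable (D : DobrushinDomain) (δ : ℝ) : Prop :=
  ∃ (c : Site 2) (C : (zdGraph 2).Walk c c), discreteDomainGraph D.carrier δ = discreteDomainGraph (dom C δ) δ

/-- **John (carrot) condition** for a Dobrushin domain, chordal form: there are a centre `z₀ ∈ D` and `c₀ > 0` such that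
every `z ∈ D` is joined to `z₀` by a path `γ` along which the distance to the complement dominates `c₀` times the distance
from `z`: `c₀ · dist (γ s) z ≤ infDist (γ s) Dᶜ` (so `γ` runs in `D` off `z`).  Discs, Lipschitz and polygonal domains and
quasidiscs satisfy it; rooms behind bottlenecks at every scale (the rosary) do not.
[folklore] -/
def IsJohnMarked (D : DobrushinDomain) : Prop :=
  ∃ (z₀ : ℂ) (c₀ : ℝ), z₀ ∈ D.carrier ∧ 0 < c₀ ∧
    ∀ z ∈ D.carrier, ∃ γ : Path z z₀, ∀ s, c₀ * dist (γ s) z ≤ infDist (γ s) D.carrierᶜ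

/-- **GERM EXCURSION MEAN on John domains** (STUB 7 of reshape r2; the repaired rate-free input): the body of
`GermExcursionMean` for Dobrushin domains satisfying `IsJohnMarked` — for every endpoint approximation there are `M̄`,
`C₀ > 11/10`, `δ₀ > 0` such that for `δ ≤ δ₀` the expected number of separate traversals of the crossover annulus
`D(δ a_δ; 1.1 d, C₀ d)`, `d = infDist (δ a_δ) Dᶜ`, is at most `M̄`, and the same at `b`.  OPEN (conjecturally true with
geometric tails); its boundary-approximation case holds on every domain (`germExcursionMean_of_bdry`).
(HYPOTHESIS NAME of the line — a definition used as a stub conclusion/hypothesis, not a literature fact; status in the line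
card.) -/
def GermExcursionMeanJohn : Prop :=
  ∀ (D : DobrushinDomain) (a b : ℝ → Site 2), IsEndpointApprox D a b → IsJohnMarked D →
    ∃ (Mbar C₀ δ₀ : ℝ), 11 / 10 < C₀ ∧ 0 < δ₀ ∧ ∀ δ ∈ Set.Ioc (0 : ℝ) δ₀,
      (∑' k : ℕ, law D.carrier δ (a δ) (b δ)
          {γ | (⟨γ.walk.toCurve (meshPoint δ)⟩ : Curve ℂ).HasTraversals (k + 1) (meshPoint δ (a δ))
            (11 / 10 * infDist (meshPoint δ (a δ)) D.carrierᶜ) (C₀ * infDist (meshPoint δ (a δ)) D.carrierᶜ)})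
        ≤ ENNReal.ofReal Mbar ∧
      (∑' k : ℕ, law D.carrier δ (a δ) (b δ)
          {γ | (⟨γ.walk.toCurve (meshPoint δ)⟩ : Curve ℂ).HasTraversals (k + 1) (meshPoint δ (b δ))
            (11 / 10 * infDist (meshPoint δ (b δ)) D.carrierᶜ) (C₀ * infDist (meshPoint δ (b δ)) D.carrierᶜ)})
        ≤ ENNReal.ofReal Mbar

/-- **Deep fragment, NECKLACE CLASS** (conclusion of STUB 6 of reshape r2): per-shell tightness at some modulus `M > 1`,
for every endpoint approximation of a JOHN Dobrushin domain, at the CARRIER-PRESENTABLE NON-PRESENTABLE meshes — the meshes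
where the slit necklace works (the hung carriers of its tail and beads are r2 carriers, `necklace_hungPresentation`).
(HYPOTHESIS NAME of the line — a definition used as a stub conclusion/hypothesis, not a literature fact.) -/
def DeepShellTightNecklace : Prop :=
  ∃ M : ℝ, 1 < M ∧ ∀ (D : DobrushinDomain) (a b : ℝ → Site 2), IsEndpointApprox D a b → IsJohnMarked D →
    ShellTightOn (fun δ => CarrierPresentable D δ ∧ ¬ Presentable D δ (a δ) (b δ)) M D a b

/-- **Deep fragment, RESIDUAL CLASS** (STUB 6r of reshape r2 — the explicit residue of the line, no mechanism on this
line): per-shell tightness at some modulus `M > 1`, for every endpoint approximation, at the non-presentable meshes OUTSIDE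
the necklace class — every non-presentable mesh of a non-John domain, and the non-carrier-presentable meshes of a John
domain (scope findings S-1: dropped lattice edges at sharp re-entrant corners; S-2: ringed exterior sites).  For tame
domains the intended treatment is comparison with a carrier-presentable companion law by local finite energy at the
boundedly many defects; OPEN for wild Jordan boundaries.
(HYPOTHESIS NAME of the line — a definition used as a stub conclusion/hypothesis, not a literature fact.) -/
def DeepShellTightResidual : Prop :=
  ∃ M : ℝ, 1 < M ∧ ∀ (D : DobrushinDomain) (a b : ℝ → Site 2), IsEndpointApprox D a b →
    ShellTightOn (fun δ => ¬ Presentable D δ (a δ) (b δ) ∧ ¬ (IsJohnMarked D ∧ CarrierPresentable D δ)) M D a b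

/-- **Cover glue of reshape r2** (registered): the necklace class and the residual class together give `DeepShellTight`
(moduli by `max`; at a John domain the two mesh classes cover the non-presentable meshes, at a non-John domain the
residual class is all of them). -/
theorem deepShellTight_of_necklace_of_residual : DeepShellTightNecklace → DeepShellTightResidual → DeepShellTight := by
  intro h₁ h₂
  obtain ⟨M₁, hM₁, H₁⟩ := h₁
  obtain ⟨M₂, -, H₂⟩ := h₂
  refine ⟨max M₁ M₂, lt_max_of_lt_left hM₁, fun D a b hab => ?_⟩
  by_cases hJ : IsJohnMarked D
  · refine shellTightOn_of_cover (shellTightOn_mono (le_max_left _ _) (H₁ D a b hab hJ))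
      (shellTightOn_mono (le_max_right _ _) (H₂ D a b hab)) fun δ hP => ?_
    by_cases hC : CarrierPresentable D δ
    · exact Or.inl ⟨hC, hP⟩
    · exact Or.inr ⟨hP, fun h => hC h.2⟩
  · have h₂' := shellTightOn_mono (le_max_right M₁ M₂) (H₂ D a b hab)
    exact shellTightOn_of_cover h₂' h₂' fun δ hP => Or.inl ⟨hP, fun h => hJ h.1⟩

end Summit.CriticalPhenomena.SAWScalingLimit.Theorems.FKGToTraversalBound.GatesByBubbleDoorsByFKG

end
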